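import Literature.NumberTheory.Sieve.SelbergSieveGBox
import Literature.NumberTheory.Sieve.Maynard2016Lemma85LamBound
import HarnessLib

/-!
# Maynard's Proposition 9.4: the weights `Y_g = y_g/φ_ω(g)` on the box `𝒟_k(𝓛)` as a Selberg box

Source: J. Maynard, *Dense clusters of primes in subsets*, Compositio Math. 152 (2016) =
arXiv:1405.2593 [Maynard2016DenseClusters], §7 p. 13–14 and proof of Proposition 9.4 pp. 25–26;
notation of [FordGreenKonyaginMaynardTao2018, §7].

This file connects the specific sieve data of `FGKMT2018MultidimensionalSieve` with the generic
Selberg-box files (`SelbergSieveGBox`, …): 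
* **`dkBox_eq_gBox`** — `𝒟_k(𝓛) = gBox (⌊R⌋, …, ⌊R⌋) (M_0, …, M_{k-1})` with the index moduli
  `M_j = idxMod 𝓛 B R j` of `FGKMT2018YSquareSumBridge`; **`lamVar_eq_lamOfY`** — `λ_d` is the
  generic `lamOfY` with `Y_r = y_r/φ_ω(r)`;
* **`yVar_F_le_of_dvd`** — `y_g ≤ y_r` for `r ∣ g` (antitonicity of Maynard's `F`);
  `phiOmega_eq_mul_prod_sdiff` — `φ_ω(n) = φ_ω(m) ∏_{p ∣ n, p ∤ m}(p - ω(p))` for `m ∣ n`;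
* **`abs_Y_le_of_dvd`** — the hypothesis of `SelbergSieveDualBound.abs_dualY_lamProd_le` for
  Maynard's weights: `|Y_g| ≤ Y_r ∏_{p ∣ g, p ∤ r} (p - k)^{-1}` for `g ∈ 𝒟_k`, `r ∣ g`.

## References
* J. Maynard, *Dense clusters of primes in subsets*, Compositio Math. 152 (2016), §7, proof of
  Prop. 9.4 [Maynard2016DenseClusters].
* K. Ford, B. Green, S. Konyagin, J. Maynard, T. Tao, *Long gaps between primes*, J. Amer. Math. Soc.
  31 (2018), §7 [FordGreenKonyaginMaynardTao2018].
-/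

noncomputable section

open Finset
open scoped ArithmeticFunction.Moebius

namespace Literature.NumberTheory.Sieve.FGKMT2018

variable {k : ℕ}

/-! ### `𝒟_k(𝓛)` is a Selberg box -/

/-- **`𝒟_k(𝓛) = gBox (fun _ ↦ ⌊R⌋) (idxMod 𝓛 B R)`**: the least-index root condition and the
coprimality to `WB` are exactly coprimality of `d_j` with the index modulus `M_j`.
[cite: Maynard2016DenseClusters, §7 p. 13 (support of λ); FordGreenKonyaginMaynardTao2018, (7.5) p. 21] -/
theorem dkBox_eq_gBox (L : Fin k → ℤ × ℤ) (B : ℕ) (R : ℝ) :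
    dkBox L B R = SelbergBox.gBox (fun _ : Fin k => ⌊R⌋₊) (idxMod L B R) := by
  classical
  ext e
  constructor
  · intro he
    have hepi : e ∈ Fintype.piFinset fun _ : Fin k => Finset.Icc 1 ⌊R⌋₊ := by
      unfold dkBox at he
      exact (Finset.mem_filter.1 he).1
    obtain ⟨hsq, hcop⟩ := (mem_dkBox_iff_coprime_idxMod hepi).1 he
    exact SelbergBox.mem_gBox.2
      ⟨fun j => Finset.mem_Icc.1 (Fintype.mem_piFinset.1 hepi j), hsq, hcop⟩
  · intro he
    obtain ⟨hb, hsq, hcop⟩ := SelbergBox.mem_gBox.1 he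
    have hepi : e ∈ Fintype.piFinset fun _ : Fin k => Finset.Icc 1 ⌊R⌋₊ :=
      Fintype.mem_piFinset.2 fun j => Finset.mem_Icc.2 (hb j)
    exact (mem_dkBox_iff_coprime_idxMod hepi).2 ⟨hsq, hcop⟩

/-- **`λ_d = lamOfY`** on the box `𝒟_k(𝓛)` with `Y_r = y_r/φ_ω(r)`.
[cite: Maynard2016DenseClusters, §7 p. 14 (definition of λ in terms of y); FordGreenKonyaginMaynardTao2018, §7 p. 21] -/
theorem lamVar_eq_lamOfY (L : Fin k → ℤ × ℤ) (B : ℕ) (R : ℝ) (F : (Fin k → ℝ) → ℝ)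
    (d : Fin k → ℕ) :
    lamVar L B R F d = SelbergBox.lamOfY (fun _ : Fin k => ⌊R⌋₊) (idxMod L B R)
      (fun r => yVar L B R F r / phiOmega L (∏ i, r i)) d := by
  unfold lamVar SelbergBox.lamOfY
  rw [dkBox_eq_gBox]
  congr! 3

/-! ### Monotonicity of `y` and the structure of `φ_ω` -/

/-- **`y_g ≤ y_r` for `r ∣ g`** (`F` is non-increasing in each argument and `log` is monotone),
given the sign of the prefactor `(WB)^k/φ(WB)^k 𝔖_{WB}(𝓛) ≥ 0`.
[cite: Maynard2016DenseClusters, proof of Lemma 8.5 p. 17 («F is decreasing in each argument»); proof of Prop. 9.4 p. 26] -/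
theorem yVar_F_le_of_dvd (hk : 2 ≤ k) (L : Fin k → ℤ × ℤ) (B : ℕ) {R : ℝ} (hR : 1 ≤ R)
    (hpref : 0 ≤ ((wCut k B * B : ℕ) : ℝ) ^ k / (Nat.totient (wCut k B * B) : ℝ) ^ k *
      singSeriesExcl L (wCut k B * B))
    {r g : Fin k → ℕ} (hr : ∀ i, 1 ≤ r i) (hg : ∀ i, 1 ≤ g i) (hrg : ∀ i, r i ∣ g i) :
    yVar L B R (MaynardDense.F k) g ≤ yVar L B R (MaynardDense.F k) r := by
  rw [yVar_eq_mul_F L B hR g hg, yVar_eq_mul_F L B hR r hr]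
  refine mul_le_mul_of_nonneg_left ?_ hpref
  refine MaynardDense.F_anti hk (logVec_mem_orthant hR r hr) fun i => ?_
  exact div_le_div_of_nonneg_right
    (Real.log_le_log (by exact_mod_cast hr i) (by exact_mod_cast Nat.le_of_dvd (hg i) (hrg i)))
    (Real.log_nonneg hR)

/-- `0 ≤ y_r` (for `rᵢ ≥ 1`, prefactor `≥ 0`). [cite: Maynard2016DenseClusters, §7 p. 14 («F non-negative»)] -/
theorem yVar_F_nonneg (hk : 2 ≤ k) (L : Fin k → ℤ × ℤ) (B : ℕ) {R : ℝ} (hR : 1 ≤ R)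
    (hpref : 0 ≤ ((wCut k B * B : ℕ) : ℝ) ^ k / (Nat.totient (wCut k B * B) : ℝ) ^ k *
      singSeriesExcl L (wCut k B * B))
    {r : Fin k → ℕ} (hr : ∀ i, 1 ≤ r i) : 0 ≤ yVar L B R (MaynardDense.F k) r := by
  rw [yVar_eq_mul_F L B hR r hr]
  exact mul_nonneg hpref (MaynardDense.F_nonneg hk (logVec_mem_orthant hR r hr))

/-- `φ_ω(n) = φ_ω(m) · ∏_{p ∣ n, p ∤ m} (p - ω(p))` for `m ∣ n ≠ 0`.
[cite: FordGreenKonyaginMaynardTao2018, (7.8) p. 21 (φ_ω multiplicative)] -/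
theorem phiOmega_eq_mul_prod_sdiff (L : Fin k → ℤ × ℤ) {m n : ℕ} (hmn : m ∣ n) (hn : n ≠ 0) :
    phiOmega L n = phiOmega L m *
      ∏ p ∈ n.primeFactors \ m.primeFactors, ((p : ℝ) - omegaL L p) := by
  unfold phiOmega
  rw [← Finset.prod_sdiff (Nat.primeFactors_mono hmn hn), mul_comm]

/-! ### The hypothesis of the `y⁺` bound for Maynard's weights -/

/-- **`|Y_g| ≤ Y_r ∏_{p ∣ g, p ∤ r} (p - k)^{-1}`** for `g ∈ 𝒟_k(𝓛)` and `r ∣ g` coordinatewise, where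
`Y = y/φ_ω` with Maynard's `F` (`k ≥ 2`, `R ≥ 1`, prefactor `≥ 0`): `y_g ≤ y_r`, and each new prime
`p` of `g` has `p ∤ WB`, so `p > 2k²` and `ω(p) ≤ k`, whence `φ_ω` gains a factor `p - ω(p) ≥ p - k > 0`.
This is the hypothesis `hY` of `SelbergSieveDualBound.abs_dualY_lamProd_le` with `A = Y_r`,
`a(p) = (p - k)^{-1}` (guarded by `k < p`).
[cite: Maynard2016DenseClusters, proof of Prop. 9.4 p. 26 («y_{r,r₀} ≪ …»); §7 p. 13 (p > 2k², ω(p) ≤ k)] -/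
theorem abs_Y_le_of_dvd (hk : 2 ≤ k) {L : Fin k → ℤ × ℤ} (hadm : FormsAdmissible L) {B : ℕ}
    {R : ℝ} (hR : 1 ≤ R)
    (hpref : 0 ≤ ((wCut k B * B : ℕ) : ℝ) ^ k / (Nat.totient (wCut k B * B) : ℝ) ^ k *
      singSeriesExcl L (wCut k B * B))
    {r g : Fin k → ℕ} (hg : g ∈ dkBox L B R) (hrg : ∀ i, r i ∣ g i) :
    |yVar L B R (MaynardDense.F k) g / phiOmega L (∏ i, g i)| ≤
      yVar L B R (MaynardDense.F k) r / phiOmega L (∏ i, r i) *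
        ∏ p ∈ (∏ i, g i).primeFactors \ (∏ i, r i).primeFactors,
          (if k < p then (((p : ℝ) - k))⁻¹ else 0) := by
  have hg1 : ∀ i, 1 ≤ g i := one_le_of_mem_dkBox hg
  have hr1 : ∀ i, 1 ≤ r i := fun i => Nat.pos_of_dvd_of_pos (hrg i) (hg1 i)
  have hr : r ∈ dkBox L B R := mem_dkBox_of_dvd hg hrg
  have hφg : 0 < phiOmega L (∏ i, g i) := phiOmega_prod_pos_of_mem_dkBox hadm hg
  have hφr : 0 < phiOmega L (∏ i, r i) := phiOmega_prod_pos_of_mem_dkBox hadm hr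
  have hyg : 0 ≤ yVar L B R (MaynardDense.F k) g := yVar_F_nonneg hk L B hR hpref hg1
  have hyr : 0 ≤ yVar L B R (MaynardDense.F k) r := yVar_F_nonneg hk L B hR hpref hr1
  have hygr := yVar_F_le_of_dvd hk L B hR hpref hr1 hg1 hrg
  have hg0 : (∏ i, g i) ≠ 0 := (squarefree_of_mem_dkBox hg).ne_zero
  have hdv : (∏ i, r i) ∣ ∏ i, g i := Finset.prod_dvd_prod_of_dvd _ _ fun i _ => hrg i
  set D := (∏ i, g i).primeFactors \ (∏ i, r i).primeFactors with hD
  -- the new primes: `p ∤ WB`, so `p > 2k² > k` and `ω(p) ≤ k`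
  have hnew : ∀ p ∈ D, p.Prime ∧ (k : ℝ) < p ∧ (omegaL L p : ℝ) ≤ k := by
    intro p hp
    have hpg := (Finset.mem_sdiff.1 hp).1
    have hpP : p.Prime := Nat.prime_of_mem_primeFactors hpg
    have hpW : ¬ p ∣ wCut k B * B := fun h =>
      (Nat.Prime.coprime_iff_not_dvd hpP).1
        (Nat.Coprime.coprime_dvd_left (Nat.dvd_of_mem_primeFactors hpg) (coprime_of_mem_dkBox hg)) h
    have h1 := two_mul_sq_lt_of_not_dvd_wCut_mul (k := k) hpP hpW
    have h2 := omegaL_le_card_of_admissible hadm hpP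
    have h3 : k < p := by nlinarith
    exact ⟨hpP, by exact_mod_cast h3, by exact_mod_cast h2⟩
  set P := ∏ p ∈ D, ((p : ℝ) - omegaL L p) with hP
  have hφeq : phiOmega L (∏ i, g i) = phiOmega L (∏ i, r i) * P :=
    phiOmega_eq_mul_prod_sdiff L hdv hg0
  have hQle : ∏ p ∈ D, ((p : ℝ) - k) ≤ P :=
    Finset.prod_le_prod (fun p hp => by have := (hnew p hp).2.1; linarith)
      fun p hp => by have := (hnew p hp).2.2; linarith
  have hQpos : 0 < ∏ p ∈ D, ((p : ℝ) - k) :=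
    Finset.prod_pos fun p hp => by have := (hnew p hp).2.1; linarith
  have hPpos : 0 < P := lt_of_lt_of_le hQpos hQle
  have hprod : ∏ p ∈ D, (if k < p then (((p : ℝ) - k))⁻¹ else 0) = (∏ p ∈ D, ((p : ℝ) - k))⁻¹ := by
    rw [← Finset.prod_inv_distrib]
    refine Finset.prod_congr rfl fun p hp => ?_
    rw [if_pos (by exact_mod_cast (hnew p hp).2.1)]
  rw [abs_of_nonneg (div_nonneg hyg hφg.le), hprod, hφeq, div_mul_eq_div_div]
  rw [div_eq_mul_inv _ P]
  refine mul_le_mul (div_le_div_of_nonneg_right hygr hφr.le) (inv_anti₀ hQpos hQle)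
    (inv_nonneg.2 hPpos.le) (div_nonneg hyr hφr.le)

end Literature.NumberTheory.Sieve.FGKMT2018
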